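import Summits.HodgeConjecture.CorCM.RationalExteriorSpan
import Mathlib.LinearAlgebra.ExteriorPower.Basis
import HarnessLib

/-!
# COR-CM model facts, exterior-algebra group: `H•(A(ℂ); ℚ) = ⋀• H¹(A(ℂ); ℚ)` with RATIONAL
# coefficients for a complex abelian variety

HONEST FRAMING (cell pub-hodgecm2 / COR-CM): a STANDARD fact about Betti cohomology on the tree's real
carriers; no case of the Hodge conjecture is proved and nothing about algebraic cycles is asserted.

The tree's theorem `Motives.abelianVarietyCohomologyExteriorH1_holds` gives, for every complex abelian
variety `A`, the bijectivity of the comparison maps `⋀ᵈ H¹(A(ℂ); ℂ) → Hᵈ(A(ℂ); ℂ)` with COMPLEX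
coefficients (`HasExteriorCohomologyH1 ℂ (ComplexPoints A.X)`; its proof uses generalised eigenspaces
of the squaring map over an algebraically closed field). This file descends it to RATIONAL coefficients:

* `finrank_bettiCohomology_eq_finrank_complexBetti` — `dim_ℚ Hᵏ(X(ℂ); ℚ) = dim_ℂ Hᵏ(X(ℂ); ℂ)` for every
  `ℂ`-scheme `X` (universal coefficients over a field, Hatcher Thm. 3.2 / Cor. 3A.6: the tree's
  `finrank_singularCohomology_eq_bettiNumber_of_field`, `bettiNumber_eq_of_algebra`);
* `hasExteriorCohomologyH1_rat` — **`HasExteriorCohomologyH1 ℚ (ComplexPoints A.X)`**: every comparison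
  map `wedgeToCup ℚ (A(ℂ)) d : ⋀ᵈ H¹(A(ℂ); ℚ) → Hᵈ(A(ℂ); ℚ)`, `v₀ ∧ ⋯ ∧ v_{d-1} ↦ v₀ ⌣ ⋯ ⌣ v_{d-1}`, is
  bijective (Mumford, *Abelian Varieties* §1 (4): `Hʳ(X, ℤ) ≅ ∧ʳ H¹(X, ℤ)`; Lange–Birkenhake Lemma 1.1.17,
  Exercise 1.1.6 (7)). SURJECTIVITY is the rational spanning theorem
  `span_range_cupPowOne_rat_eq_top` of `CorCM/RationalExteriorSpan.lean` (`range_wedgeToCup` = span of the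
  iterated cup products); INJECTIVITY then follows by the dimension count
  `dim_ℚ ⋀ᵈ H¹(A(ℂ); ℚ) = (2 dim A choose d) = dim_ℂ Hᵈ(A(ℂ); ℂ) = dim_ℚ Hᵈ(A(ℂ); ℚ)`
  (Mathlib `exteriorPower.finrank_eq`; the tree's `abelianVarietyCohomologyExteriorH1.finrank_eq`);
* `ratWedgeEquiv` is NOT introduced as a definition (this file is definition-free); consumers use
  `LinearEquiv.ofBijective (wedgeToCup ℚ _ d) (hasExteriorCohomologyH1_rat A d)` and the corollaries
  `finrank_bettiCohomology_abelianVariety`, `linearIndependent_cupPowOne_of_linearIndependent`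
  (wedges of the `d`-subsets of a `ℚ`-linearly independent family of degree-one classes are linearly
  independent in `Hᵈ(A(ℂ); ℚ)` — Mathlib `exteriorPower.ιMulti_family_linearIndependent_field` pushed
  through the injective comparison map).

Use in the cell: the rational Weil line `W_K(P) ⊂ H⁴(P, ℚ)` of the corner product (model axiom M15
`Fact_weilLine_rank`) is analysed inside `⋀⁴ H¹(P, ℚ)` through this isomorphism.

## References
* [MumfordAV1970] D. Mumford, *Abelian Varieties* (1970), §1 (3)–(4).
* [LangeBirkenhake1992] H. Lange, Ch. Birkenhake, *Complex Abelian Varieties* (1992), Lemma 1.1.17,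
  Cor. 1.1.19, Exercise 1.1.6 (7)–(8).
* [HatcherAT2002] A. Hatcher, *Algebraic Topology* (2002), §3.1 Thm. 3.2, §3.A Cor. 3A.6.
-/

noncomputable section

open CategoryTheory
open Literature.AlgebraicTopology.SingularHomology
open Literature.AlgebraicGeometry Literature.AlgebraicGeometry.Motives Literature.AlgebraicGeometry.HodgeTheory

namespace Summit.HodgeConjecture.CorCM.Model

/-- **Universal coefficients, dimension form**: `dim_ℚ Hᵏ(X(ℂ); ℚ) = dim_ℂ Hᵏ(X(ℂ); ℂ)` for every
`ℂ`-scheme `X` (both equal the `k`-th Betti number of `X(ℂ)`). [cite: HatcherAT2002, §3.1 Thm. 3.2 and §3.A Cor. 3A.6] -/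
theorem finrank_bettiCohomology_eq_finrank_complexBetti (X : SchemeOver ℂ) (k : ℕ) :
    Module.finrank ℚ (bettiCohomology X k) = Module.finrank ℂ (complexBetti X k) := by
  change Module.finrank ℚ (singularCohomology ℚ ℚ (ComplexPoints X) k) =
    Module.finrank ℂ (singularCohomology ℂ ℂ (ComplexPoints X) k)
  rw [finrank_singularCohomology_eq_bettiNumber_of_field, finrank_singularCohomology_eq_bettiNumber_of_field,
    bettiNumber_eq_of_algebra ℚ ℂ]

section AbelianVariety

variable (A : AbelianVariety ℂ)

/-- `dim_ℚ Hᵈ(A(ℂ); ℚ) = (2 dim A choose d)` for a complex abelian variety.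
[cite: LangeBirkenhake1992, Exercise 1.1.6 (8)] [cite: MumfordAV1970, §1 (4)] -/
theorem finrank_bettiCohomology_abelianVariety (d : ℕ) :
    Module.finrank ℚ (bettiCohomology A.X d) = Nat.choose (2 * A.dim) d := by
  rw [finrank_bettiCohomology_eq_finrank_complexBetti, abelianVarietyCohomologyExteriorH1_holds.finrank_eq A d]

/-- **`H•(A(ℂ); ℚ) = ⋀• H¹(A(ℂ); ℚ)` for a complex abelian variety `A`** (rational coefficients): every
comparison map `⋀ᵈ H¹(A(ℂ); ℚ) → Hᵈ(A(ℂ); ℚ)`, `v₀ ∧ ⋯ ∧ v_{d-1} ↦ v₀ ⌣ ⋯ ⌣ v_{d-1}`, is bijective —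
surjective by the rational spanning theorem `span_range_cupPowOne_rat_eq_top`, injective by the dimension
count against the complex case. [cite: MumfordAV1970, §1 (4)] [cite: LangeBirkenhake1992, Lemma 1.1.17 and Exercise 1.1.6 (7)] -/
theorem hasExteriorCohomologyH1_rat : HasExteriorCohomologyH1 ℚ (ComplexPoints A.X) := by
  intro d
  have hX : IsSmoothProjective A.dim A.X := AbelianVariety.isSmoothProjective_holds (A := A)
  haveI : FiniteDimensional ℚ (singularCohomology ℚ ℚ (ComplexPoints A.X) 1) :=
    finiteDimensional_bettiCohomology hX 1
  haveI : FiniteDimensional ℚ (singularCohomology ℚ ℚ (ComplexPoints A.X) d) :=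
    finiteDimensional_bettiCohomology hX d
  have hsurj : Function.Surjective (wedgeToCup ℚ (ComplexPoints A.X) d) := by
    rw [← LinearMap.range_eq_top, range_wedgeToCup, span_range_cupPowOne_rat_eq_top]
  have hdim : Module.finrank ℚ (⋀[ℚ]^d (singularCohomology ℚ ℚ (ComplexPoints A.X) 1)) =
      Module.finrank ℚ (singularCohomology ℚ ℚ (ComplexPoints A.X) d) := by
    rw [exteriorPower.finrank_eq]
    change Nat.choose (Module.finrank ℚ (bettiCohomology A.X 1)) d = Module.finrank ℚ (bettiCohomology A.X d)
    rw [finrank_bettiCohomology_abelianVariety, finrank_bettiCohomology_abelianVariety, Nat.choose_one_right]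
  exact ⟨(LinearMap.injective_iff_surjective_of_finrank_eq_finrank hdim).2 hsurj, hsurj⟩

/-- **Wedges of a linearly independent family of rational degree-one classes are linearly independent**:
for a `ℚ`-linearly independent family `v : I → H¹(A(ℂ); ℚ)` (indexed by a linear order), the iterated cup
products `m_d(v ∘ s)` over the `d`-element subsets `s ⊆ I` form a linearly independent family in
`Hᵈ(A(ℂ); ℚ)` (Mathlib `exteriorPower.ιMulti_family_linearIndependent_field`, pushed through the injective
comparison map). [cite: LangeBirkenhake1992, Lemma 1.1.17 and Exercise 1.1.6 (7)] -/
theorem linearIndependent_cupPowOne_of_linearIndependent {I : Type*} [LinearOrder I] (d : ℕ)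
    {v : I → bettiCohomology A.X 1} (hv : LinearIndependent ℚ v) :
    LinearIndependent ℚ (fun s : Set.powersetCard I d =>
      wedgeToCup ℚ (ComplexPoints A.X) d (exteriorPower.ιMulti_family ℚ d v s)) :=
  (exteriorPower.ιMulti_family_linearIndependent_field (n := d) hv).map'
    (wedgeToCup ℚ (ComplexPoints A.X) d) (LinearMap.ker_eq_bot.2 (hasExteriorCohomologyH1_rat A d).1)

end AbelianVariety

end Summit.HodgeConjecture.CorCM.Model

end
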